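import Summits.AtomisticToContinuum.Crystallization.Theorems.OverbindingBudgetAffineCompressedCutDict

/-!
# NODE g79 «CompressedCut», toward the open leaf NS♭₂ — DISTANCE CLASSES of the frame dictionary (second brick of the FRAME half)

Route `OverbindingBudget` (Crystallization), crux `RobustDefectLimitWindows` (stmt-AtomisticToContinuum-31280), decomp-a2c lens 4, generation 79, ADDENDUM 5.
Companion of `…OverbindingBudgetAffineCompressedCutScale` (SCALE half) and `…OverbindingBudgetAffineCompressedCutDict` (the dictionary `v − v_k ↦ w` between the
affine frames `(Q, A, P, f)` at `j`, scale `s`, and `(Q', A', P', f')` at an adjacent site `k = f v_k`, scale `s'`, with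
`‖s'·A' w − s·(A v − A v_k)‖ ≤ 2ε·s + ε·s'`).  PROVED here, potential-free:

* §1–§3  the SQUARED-DISTANCE TABLES of the two-shell patterns, by integer arithmetic (`decide`) on the tree's integer models and transfer through
  `scaledPattern`: for `x, z ∈ P ∪ {0}`, `P ∈ {fcc, hcp}` two-shell pattern, `dist x z ^ 2 ∈ {0, 1, 2, 8/3, 3, 11/3, 4, 5, 17/3, 20/3, 8}` (as rationals), and any two
  members of that class set differ by at least `1/3`;
* §4  `dict_pair`, `dict_distScaled` — two dictionary entries give `|s'·‖w₁ − w₂‖ − s·‖v₁ − v₂‖| ≤ 2θ·(s + s') + 2·(2ε·s + ε·s')` (frame distortion `± 2θ` on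
  differences of pattern points, nothing else);
* §5  ★ `dict_distClass_record` — at the record literals `(ε, θ) = (10⁻⁴, 10⁻³)` with the SCALE half's two-sided comparison `9967/10⁴·s ≤ s' ≤ 10011/10⁴·s`, the
  dictionary PRESERVES DISTANCES EXACTLY on `P ∪ {0}`: `dist w₁ w₂ = dist v₁ v₂` (errors `< 0.09` in squared distance against the class gap `1/3`); with the
  norm classes of the Dict rider this is GRAM preservation by polarisation (`inner_eq_of_norm_eq`, `dict_gram`), so the dictionary is the restriction of a
  linear isometry as soon as its domain has rank 3 (memo NODE-g79 §5, RIGIDITY FINDING: it always has — 9 vectors of rank 3).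

Deps: tree only (`…OverbindingBudgetAffineCompressedCutDict` p853567, for `frame_diff_le` / `le_frame_diff`; it imports `…AffineLadder`).  Tree relative NOT imported here: `Literature.Geometry.DiscreteGeometry.TwoShellIntegerModel` (the common
`√18` model `fccModelInt` / `hcpModelInt`, `dist_sq_intVec_div` at `N = 18`, and the integer Cramer rule `cramerInt_spec` — the tools for the remaining steps of the
frame half: an independent triple in the dictionary's domain and Gram-determined coordinates); `dist_sq_eq_of_mem_scaledPattern` below is the general-`N`
membership form matching the `decide`d tables of `TwoShellPatterns`.  No `instance`, no `notation`, no new axioms, 0 sorry.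
-/

namespace Summit.AtomisticToContinuum.Crystallization.Theorems.OverbindingBudgetAffineCompressedCutClasses

open Summit.AtomisticToContinuum.Crystallization.Theorems.OverbindingBudgetAffineCompressedCutDict (frame_diff_le le_frame_diff)
open Literature.Geometry.DiscreteGeometry (sqNormInt intVec intVec_sub norm_intVec scaledPattern fccInt hcpInt fccSecondShellInt
  hcpSecondShellInt fccTwoShellPattern hcpTwoShellPattern norm_of_mem_fccTwoShellPattern norm_of_mem_hcpTwoShellPattern
  norm_le_sqrt_two_of_mem_twoShellPattern)

/-! ## §1  Integer squared-distance tables -/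

/-- Squared distances in the fcc two-shell integer model (scale `√2`): `{0, 2, 4, 6, 8, 10, 16}`. [folklore; this file, by `decide`] -/
theorem sqNormInt_sub_mem_fccTwoShellInt : ∀ v ∈ fccInt ∪ fccSecondShellInt, ∀ w ∈ fccInt ∪ fccSecondShellInt,
    sqNormInt (v - w) ∈ ({0, 2, 4, 6, 8, 10, 16} : Finset ℤ) := by
  decide

/-- Squared distances in the hcp two-shell integer model (scale `3√2`): `{0, 18, 36, 48, 54, 66, 72, 90, 102, 120}`.
[folklore; this file, by `decide`] -/
theorem sqNormInt_sub_mem_hcpTwoShellInt : ∀ v ∈ hcpInt ∪ hcpSecondShellInt, ∀ w ∈ hcpInt ∪ hcpSecondShellInt,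
    sqNormInt (v - w) ∈ ({0, 18, 36, 48, 54, 66, 72, 90, 102, 120} : Finset ℤ) := by
  decide

/-! ## §2  The common rational class set `{0, 1, 2, 8/3, 3, 11/3, 4, 5, 17/3, 20/3, 8}` -/

/-- The fcc table, divided by `2`, lies in the class set. [this file] -/
theorem fccTable_div_two_mem : ∀ k ∈ ({0, 2, 4, 6, 8, 10, 16} : Finset ℤ),
    (k : ℚ) / 2 ∈ ({0, 1, 2, 8 / 3, 3, 11 / 3, 4, 5, 17 / 3, 20 / 3, 8} : Finset ℚ) := by
  simp only [Finset.mem_insert, Finset.mem_singleton, forall_eq_or_imp, forall_eq]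
  norm_num

/-- The hcp table, divided by `18`, lies in the class set. [this file] -/
theorem hcpTable_div_eighteen_mem : ∀ k ∈ ({0, 18, 36, 48, 54, 66, 72, 90, 102, 120} : Finset ℤ),
    (k : ℚ) / 18 ∈ ({0, 1, 2, 8 / 3, 3, 11 / 3, 4, 5, 17 / 3, 20 / 3, 8} : Finset ℚ) := by
  simp only [Finset.mem_insert, Finset.mem_singleton, forall_eq_or_imp, forall_eq]
  norm_num

/-- SEPARATION: two distinct members of the class set differ by at least `1/3`. [this file] -/
theorem classSet_sep : ∀ p ∈ ({0, 1, 2, 8 / 3, 3, 11 / 3, 4, 5, 17 / 3, 20 / 3, 8} : Finset ℚ),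
    ∀ q ∈ ({0, 1, 2, 8 / 3, 3, 11 / 3, 4, 5, 17 / 3, 20 / 3, 8} : Finset ℚ), p ≠ q → (1 : ℚ) / 3 ≤ |p - q| := by
  simp only [Finset.mem_insert, Finset.mem_singleton, forall_eq_or_imp, forall_eq]
  norm_num [abs_of_nonneg, abs_of_nonpos]

/-- Hence two members of the class set at real distance `< 1/3` are equal. [this file] -/
theorem classSet_eq_of_abs_sub_lt {p q : ℚ} (hp : p ∈ ({0, 1, 2, 8 / 3, 3, 11 / 3, 4, 5, 17 / 3, 20 / 3, 8} : Finset ℚ))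
    (hq : q ∈ ({0, 1, 2, 8 / 3, 3, 11 / 3, 4, 5, 17 / 3, 20 / 3, 8} : Finset ℚ)) (h : |(p : ℝ) - q| < 1 / 3) : p = q := by
  by_contra hne
  have h3 := classSet_sep p hp q hq hne
  have h4 : (((1 : ℚ) / 3 : ℚ) : ℝ) ≤ ((|p - q| : ℚ) : ℝ) := by exact_mod_cast h3
  push_cast at h4
  linarith

/-! ## §3  Transfer to the patterns -/

/-- Squared distances in a scaled integer pattern. [folklore; this file] -/
theorem dist_sq_eq_of_mem_scaledPattern {S : Finset (Fin 3 → ℤ)} {M : ℕ} (hM : M ≠ 0) {x z : EuclideanSpace ℝ (Fin 3)}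
    (hx : x ∈ scaledPattern S M) (hz : z ∈ scaledPattern S M) :
    ∃ v ∈ S, ∃ w ∈ S, dist x z ^ 2 = (sqNormInt (v - w) : ℝ) / M := by
  obtain ⟨v, hv, rfl⟩ := Finset.mem_image.1 hx
  obtain ⟨w, hw, rfl⟩ := Finset.mem_image.1 hz
  refine ⟨v, hv, w, hw, ?_⟩
  have hpos : (0 : ℝ) < Real.sqrt M := by positivity
  have hnn : (0 : ℝ) ≤ (sqNormInt (v - w) : ℝ) := by
    have h0 : (0 : ℤ) ≤ sqNormInt (v - w) := by unfold sqNormInt; positivity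
    exact_mod_cast h0
  rw [dist_eq_norm, ← smul_sub, intVec_sub, norm_smul, norm_inv, Real.norm_of_nonneg hpos.le, norm_intVec, mul_pow,
    inv_pow, Real.sq_sqrt (by positivity : (0 : ℝ) ≤ M), Real.sq_sqrt hnn, inv_mul_eq_div]

/-- **DISTANCE CLASSES** of a two-shell pattern: `dist x z ^ 2 ∈ {0, 1, 2, 8/3, 3, 11/3, 4, 5, 17/3, 20/3, 8}`. [cite: HalesDSP2012, §1.3; this file] -/
theorem dist_sq_class {P : Finset (EuclideanSpace ℝ (Fin 3))} (hP : P = fccTwoShellPattern ∨ P = hcpTwoShellPattern)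
    {x z : EuclideanSpace ℝ (Fin 3)} (hx : x ∈ P) (hz : z ∈ P) :
    ∃ q ∈ ({0, 1, 2, 8 / 3, 3, 11 / 3, 4, 5, 17 / 3, 20 / 3, 8} : Finset ℚ), dist x z ^ 2 = (q : ℝ) := by
  rcases hP with rfl | rfl
  · obtain ⟨v, hv, w, hw, h⟩ := dist_sq_eq_of_mem_scaledPattern two_ne_zero hx hz
    refine ⟨(sqNormInt (v - w) : ℚ) / 2, fccTable_div_two_mem _ (sqNormInt_sub_mem_fccTwoShellInt v hv w hw), ?_⟩
    rw [h]; push_cast; ring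
  · obtain ⟨v, hv, w, hw, h⟩ := dist_sq_eq_of_mem_scaledPattern (by norm_num) hx hz
    refine ⟨(sqNormInt (v - w) : ℚ) / 18, hcpTable_div_eighteen_mem _ (sqNormInt_sub_mem_hcpTwoShellInt v hv w hw), ?_⟩
    rw [h]; push_cast; ring

/-- Squared norms of two-shell pattern points: `1` or `2`, in the class set. [this file] -/
theorem norm_sq_class {P : Finset (EuclideanSpace ℝ (Fin 3))} (hP : P = fccTwoShellPattern ∨ P = hcpTwoShellPattern)
    {x : EuclideanSpace ℝ (Fin 3)} (hx : x ∈ P) :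
    ∃ q ∈ ({0, 1, 2, 8 / 3, 3, 11 / 3, 4, 5, 17 / 3, 20 / 3, 8} : Finset ℚ), ‖x‖ ^ 2 = (q : ℝ) := by
  have hcl : ‖x‖ = 1 ∨ ‖x‖ = Real.sqrt 2 := by
    rcases hP with rfl | rfl
    · exact norm_of_mem_fccTwoShellPattern hx
    · exact norm_of_mem_hcpTwoShellPattern hx
  rcases hcl with h | h
  · exact ⟨1, by simp, by rw [h]; norm_num⟩
  · exact ⟨2, by simp, by rw [h]; rw [Real.sq_sqrt (by norm_num)]; norm_num⟩

/-- Distance classes on `P ∪ {0}` (the dictionary's domain and range include the centre). [this file] -/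
theorem dist_sq_class₀ {P : Finset (EuclideanSpace ℝ (Fin 3))} (hP : P = fccTwoShellPattern ∨ P = hcpTwoShellPattern)
    {x z : EuclideanSpace ℝ (Fin 3)} (hx : x ∈ insert (0 : EuclideanSpace ℝ (Fin 3)) P)
    (hz : z ∈ insert (0 : EuclideanSpace ℝ (Fin 3)) P) :
    ∃ q ∈ ({0, 1, 2, 8 / 3, 3, 11 / 3, 4, 5, 17 / 3, 20 / 3, 8} : Finset ℚ), dist x z ^ 2 = (q : ℝ) := by
  rcases Finset.mem_insert.mp hx with rfl | hx'
  · rcases Finset.mem_insert.mp hz with rfl | hz'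
    · exact ⟨0, by simp, by simp⟩
    · rw [dist_comm, dist_zero_right]; exact norm_sq_class hP hz'
  · rcases Finset.mem_insert.mp hz with rfl | hz'
    · rw [dist_zero_right]; exact norm_sq_class hP hx'
    · exact dist_sq_class hP hx' hz'

/-- A frame bound on `P` extends to `P ∪ {0}` (both maps fix the origin). [this file] -/
theorem frame_insert_zero {θ : ℝ} (hθ : 0 ≤ θ) {A : EuclideanSpace ℝ (Fin 3) →ₗ[ℝ] EuclideanSpace ℝ (Fin 3)}
    {Q : EuclideanSpace ℝ (Fin 3) →ₗᵢ[ℝ] EuclideanSpace ℝ (Fin 3)} {P : Finset (EuclideanSpace ℝ (Fin 3))}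
    (hA : ∀ v ∈ P, ‖A v - Q v‖ ≤ θ) : ∀ v ∈ insert (0 : EuclideanSpace ℝ (Fin 3)) P, ‖A v - Q v‖ ≤ θ := by
  intro v hv
  rcases Finset.mem_insert.mp hv with rfl | hv'
  · simpa using hθ
  · exact hA v hv'

/-! ## §4  Two dictionary entries: the scaled distance comparison -/

/-- **PAIR INEQUALITY**: two dictionary entries with the same base `v_k` compare the difference vectors. [this file] -/
theorem dict_pair {s s' e : ℝ} {A A' : EuclideanSpace ℝ (Fin 3) →ₗ[ℝ] EuclideanSpace ℝ (Fin 3)}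
    {v₁ v₂ vk w₁ w₂ : EuclideanSpace ℝ (Fin 3)}
    (h₁ : ‖s' • A' w₁ - s • (A v₁ - A vk)‖ ≤ e) (h₂ : ‖s' • A' w₂ - s • (A v₂ - A vk)‖ ≤ e) :
    ‖s' • (A' w₁ - A' w₂) - s • (A v₁ - A v₂)‖ ≤ 2 * e := by
  have h3 : s' • (A' w₁ - A' w₂) - s • (A v₁ - A v₂)
      = (s' • A' w₁ - s • (A v₁ - A vk)) - (s' • A' w₂ - s • (A v₂ - A vk)) := by
    simp only [smul_sub]; abel
  rw [h3]
  exact (norm_sub_le _ _).trans (by linarith)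

/-- **SCALED DISTANCE COMPARISON**: `|s'·‖w₁ − w₂‖ − s·‖v₁ − v₂‖| ≤ 2θ·(s + s') + 2e` from the pair inequality and the two frame bounds.
[this file] -/
theorem dict_distScaled {θ s s' e : ℝ} (hs : 0 ≤ s) (hs' : 0 ≤ s')
    {A A' : EuclideanSpace ℝ (Fin 3) →ₗ[ℝ] EuclideanSpace ℝ (Fin 3)} {Q Q' : EuclideanSpace ℝ (Fin 3) →ₗᵢ[ℝ] EuclideanSpace ℝ (Fin 3)}
    {P P' : Finset (EuclideanSpace ℝ (Fin 3))} (hA : ∀ v ∈ P, ‖A v - Q v‖ ≤ θ) (hA' : ∀ w ∈ P', ‖A' w - Q' w‖ ≤ θ)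
    {v₁ v₂ w₁ w₂ : EuclideanSpace ℝ (Fin 3)} (hv₁ : v₁ ∈ P) (hv₂ : v₂ ∈ P) (hw₁ : w₁ ∈ P') (hw₂ : w₂ ∈ P')
    (hpair : ‖s' • (A' w₁ - A' w₂) - s • (A v₁ - A v₂)‖ ≤ 2 * e) :
    |s' * ‖w₁ - w₂‖ - s * ‖v₁ - v₂‖| ≤ 2 * θ * (s + s') + 2 * e := by
  have hrev := abs_norm_sub_norm_le (s' • (A' w₁ - A' w₂)) (s • (A v₁ - A v₂))
  rw [norm_smul, norm_smul, Real.norm_of_nonneg hs', Real.norm_of_nonneg hs] at hrev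
  have hb := abs_le.mp (hrev.trans hpair)
  have p1 := mul_le_mul_of_nonneg_left (frame_diff_le hA' hw₁ hw₂) hs'
  have p2 := mul_le_mul_of_nonneg_left (le_frame_diff hA' hw₁ hw₂) hs'
  have p3 := mul_le_mul_of_nonneg_left (frame_diff_le hA hv₁ hv₂) hs
  have p4 := mul_le_mul_of_nonneg_left (le_frame_diff hA hv₁ hv₂) hs
  rw [abs_le]
  constructor
  · linarith [hb.1]
  · linarith [hb.2]

/-! ## §5  Distance-class preservation at the record literals, and Gram preservation -/

/-- Norms on `P ∪ {0}` are at most `3/2` (`√2 ≤ 3/2`). [this file] -/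
theorem norm_le_three_halves₀ {P : Finset (EuclideanSpace ℝ (Fin 3))} (hP : P = fccTwoShellPattern ∨ P = hcpTwoShellPattern)
    {x : EuclideanSpace ℝ (Fin 3)} (hx : x ∈ insert (0 : EuclideanSpace ℝ (Fin 3)) P) : ‖x‖ ≤ 3 / 2 := by
  rcases Finset.mem_insert.mp hx with rfl | hx'
  · rw [norm_zero]; norm_num
  · have h2 : Real.sqrt 2 ≤ 3 / 2 := by
      rw [Real.sqrt_le_left (by norm_num)]; norm_num
    exact (norm_le_sqrt_two_of_mem_twoShellPattern hP hx').trans h2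

/-- ★ **DISTANCE-CLASS PRESERVATION (record literals).**  At `(ε, θ) = (10⁻⁴, 10⁻³)` and under the SCALE half's comparison `9967/10⁴·s ≤ s' ≤ 10011/10⁴·s`,
two dictionary entries `(v₁, w₁)`, `(v₂, w₂)` over `P ∪ {0} → P' ∪ {0}` satisfy `dist w₁ w₂ = dist v₁ v₂` EXACTLY. [this file] -/
theorem dict_distClass_record {s s' : ℝ} (hs : 0 < s) (hsc : 9967 / 10000 * s ≤ s') (hsc' : s' ≤ 10011 / 10000 * s)
    {A A' : EuclideanSpace ℝ (Fin 3) →ₗ[ℝ] EuclideanSpace ℝ (Fin 3)} {Q Q' : EuclideanSpace ℝ (Fin 3) →ₗᵢ[ℝ] EuclideanSpace ℝ (Fin 3)}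
    {P P' : Finset (EuclideanSpace ℝ (Fin 3))} (hP : P = fccTwoShellPattern ∨ P = hcpTwoShellPattern)
    (hP' : P' = fccTwoShellPattern ∨ P' = hcpTwoShellPattern)
    (hA : ∀ v ∈ P, ‖A v - Q v‖ ≤ 1 / 1000) (hA' : ∀ w ∈ P', ‖A' w - Q' w‖ ≤ 1 / 1000)
    {v₁ v₂ vk w₁ w₂ : EuclideanSpace ℝ (Fin 3)}
    (hv₁ : v₁ ∈ insert (0 : EuclideanSpace ℝ (Fin 3)) P) (hv₂ : v₂ ∈ insert (0 : EuclideanSpace ℝ (Fin 3)) P)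
    (hw₁ : w₁ ∈ insert (0 : EuclideanSpace ℝ (Fin 3)) P') (hw₂ : w₂ ∈ insert (0 : EuclideanSpace ℝ (Fin 3)) P')
    (h₁ : ‖s' • A' w₁ - s • (A v₁ - A vk)‖ ≤ 2 * (1 / 10 ^ 4) * s + 1 / 10 ^ 4 * s')
    (h₂ : ‖s' • A' w₂ - s • (A v₂ - A vk)‖ ≤ 2 * (1 / 10 ^ 4) * s + 1 / 10 ^ 4 * s') :
    dist w₁ w₂ = dist v₁ v₂ := by
  have hs' : 0 ≤ s' := by linarith
  have hθ : (0 : ℝ) ≤ 1 / 1000 := by norm_num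
  have hsc0 := dict_distScaled hs.le hs' (frame_insert_zero hθ hA) (frame_insert_zero hθ hA') hv₁ hv₂ hw₁ hw₂ (dict_pair h₁ h₂)
  rw [← dist_eq_norm, ← dist_eq_norm] at hsc0
  obtain ⟨p, hp, hpv⟩ := dist_sq_class₀ hP hv₁ hv₂
  obtain ⟨q, hq, hqw⟩ := dist_sq_class₀ hP' hw₁ hw₂
  -- sizes
  have ha0 : 0 ≤ dist v₁ v₂ := dist_nonneg
  have hb0 : 0 ≤ dist w₁ w₂ := dist_nonneg
  have ha3 : dist v₁ v₂ ≤ 3 := by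
    rw [dist_eq_norm]
    exact (norm_sub_le _ _).trans (by linarith [norm_le_three_halves₀ hP hv₁, norm_le_three_halves₀ hP hv₂])
  have hb3 : dist w₁ w₂ ≤ 3 := by
    rw [dist_eq_norm]
    exact (norm_sub_le _ _).trans (by linarith [norm_le_three_halves₀ hP' hw₁, norm_le_three_halves₀ hP' hw₂])
  -- divide the scaled comparison by `s`
  have hab := abs_le.mp hsc0
  have q1 : 9967 / 10000 * s * dist w₁ w₂ ≤ s' * dist w₁ w₂ := mul_le_mul_of_nonneg_right hsc hb0
  have q2 : s' * dist w₁ w₂ ≤ 10011 / 10000 * s * dist w₁ w₂ := mul_le_mul_of_nonneg_right hsc' hb0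
  have hup : s * dist v₁ v₂ ≤ s * (10011 / 10000 * dist w₁ w₂ + 47 / 10000) := by nlinarith [hab.1, hab.2]
  have hdn : s * (9967 / 10000 * dist w₁ w₂) ≤ s * (dist v₁ v₂ + 47 / 10000) := by nlinarith [hab.1, hab.2]
  have hup' := le_of_mul_le_mul_left hup hs
  have hdn' := le_of_mul_le_mul_left hdn hs
  -- squared distances differ by less than `1/3`
  have t1 : (dist v₁ v₂ - dist w₁ w₂) * (dist v₁ v₂ + dist w₁ w₂) ≤ 80 / 10000 * (dist v₁ v₂ + dist w₁ w₂) :=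
    mul_le_mul_of_nonneg_right (by linarith) (by linarith)
  have t2 : (dist w₁ w₂ - dist v₁ v₂) * (dist v₁ v₂ + dist w₁ w₂) ≤ 146 / 10000 * (dist v₁ v₂ + dist w₁ w₂) :=
    mul_le_mul_of_nonneg_right (by linarith) (by linarith)
  have hlt : |(q : ℝ) - p| < 1 / 3 := by
    rw [← hqw, ← hpv, abs_sub_lt_iff]
    constructor <;> nlinarith [t1, t2]
  have hqp : q = p := classSet_eq_of_abs_sub_lt hq hp hlt
  have hsq : dist w₁ w₂ ^ 2 = dist v₁ v₂ ^ 2 := by rw [hqw, hpv, hqp]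
  exact (pow_left_inj₀ hb0 ha0 two_ne_zero).mp hsq

/-- POLARISATION: equal norms and equal distance give equal inner product. [folklore; this file] -/
theorem inner_eq_of_norm_eq {u₁ u₂ w₁ w₂ : EuclideanSpace ℝ (Fin 3)} (h₁ : ‖w₁‖ = ‖u₁‖) (h₂ : ‖w₂‖ = ‖u₂‖)
    (h₁₂ : ‖w₁ - w₂‖ = ‖u₁ - u₂‖) : inner ℝ w₁ w₂ = inner ℝ u₁ u₂ := by
  have a := norm_sub_sq_real w₁ w₂
  have b := norm_sub_sq_real u₁ u₂
  rw [h₁₂, h₁, h₂] at a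
  linarith

/-- ★ **GRAM PRESERVATION (record literals).**  With the norm classes of the Dict rider (`‖wᵢ‖ = ‖vᵢ − v_k‖`, hypotheses here) and distance-class
preservation, the dictionary preserves inner products: `⟪w₁, w₂⟫ = ⟪v₁ − v_k, v₂ − v_k⟫`. [this file] -/
theorem dict_gram_record {s s' : ℝ} (hs : 0 < s) (hsc : 9967 / 10000 * s ≤ s') (hsc' : s' ≤ 10011 / 10000 * s)
    {A A' : EuclideanSpace ℝ (Fin 3) →ₗ[ℝ] EuclideanSpace ℝ (Fin 3)} {Q Q' : EuclideanSpace ℝ (Fin 3) →ₗᵢ[ℝ] EuclideanSpace ℝ (Fin 3)}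
    {P P' : Finset (EuclideanSpace ℝ (Fin 3))} (hP : P = fccTwoShellPattern ∨ P = hcpTwoShellPattern)
    (hP' : P' = fccTwoShellPattern ∨ P' = hcpTwoShellPattern)
    (hA : ∀ v ∈ P, ‖A v - Q v‖ ≤ 1 / 1000) (hA' : ∀ w ∈ P', ‖A' w - Q' w‖ ≤ 1 / 1000)
    {v₁ v₂ vk w₁ w₂ : EuclideanSpace ℝ (Fin 3)}
    (hv₁ : v₁ ∈ insert (0 : EuclideanSpace ℝ (Fin 3)) P) (hv₂ : v₂ ∈ insert (0 : EuclideanSpace ℝ (Fin 3)) P)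
    (hw₁ : w₁ ∈ insert (0 : EuclideanSpace ℝ (Fin 3)) P') (hw₂ : w₂ ∈ insert (0 : EuclideanSpace ℝ (Fin 3)) P')
    (h₁ : ‖s' • A' w₁ - s • (A v₁ - A vk)‖ ≤ 2 * (1 / 10 ^ 4) * s + 1 / 10 ^ 4 * s')
    (h₂ : ‖s' • A' w₂ - s • (A v₂ - A vk)‖ ≤ 2 * (1 / 10 ^ 4) * s + 1 / 10 ^ 4 * s')
    (hn₁ : ‖w₁‖ = ‖v₁ - vk‖) (hn₂ : ‖w₂‖ = ‖v₂ - vk‖) :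
    inner ℝ w₁ w₂ = inner ℝ (v₁ - vk) (v₂ - vk) := by
  have hd := dict_distClass_record hs hsc hsc' hP hP' hA hA' hv₁ hv₂ hw₁ hw₂ h₁ h₂
  rw [dist_eq_norm, dist_eq_norm] at hd
  refine inner_eq_of_norm_eq hn₁ hn₂ ?_
  rw [hd]; congr 1; abel

end Summit.AtomisticToContinuum.Crystallization.Theorems.OverbindingBudgetAffineCompressedCutClasses
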